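import Summits.BirchSwinnertonDyer.BirchSwinnertonDyer.Theorems.PrintCf2SplitBadTwoRestrictedSelmerNoFiniteSubmoduleOfLift
import Summits.BirchSwinnertonDyer.BirchSwinnertonDyer.Theorems.PrintCf2SplitBadTwoRestrictedSelmerCMSideConditions
import Summits.BirchSwinnertonDyer.Rank1Residual.X11b.ProcyclicDescent
import Literature.NumberTheory.EllipticCurves.IwasawaSelmerProofs
import HarnessLib

/-!
# Crux `PrintCf2.SplitBadTwoRankOneOfFacts` (stmt-BirchSwinnertonDyer-20368), road α (v10.3, S3c) — brick B17, file 7: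
# NO TWIST NEEDED — `H²(Γ_K, W*) = 0` makes `conj_γ − 1` ONTO the FULL `H¹(K*_∞, W*)` (the tree's GENERIC procyclic descent,
# `X11b.ProcyclicDescent`), so B17 ⟸ «`H²(Γ_K, W*) = 0`» ∧ «the BASE LIFT: a class of `H¹(K*_∞, W*)` whose `Γ`-coboundary is Selmer
# is Selmer modulo a class restricted from `K`» — JSW17 Lemma 3.3.3's two halves for Agboola's restricted Selmer group

Cell `bsd-print-cf2`, EXTRA WIDTH seat `bsd-line-cf2-p1-w4` g8 (prover-bsd-line-cf2-p1-w4-g8-0); `--supports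
stmt-BirchSwinnertonDyer-20368` (helper, Theses-free). HONEST FRAMING: nothing here closes the crux or a registered stub; BSD is
not proved by any of this; no summit statement is proved by this seat. No definition, no named fact, no `sorry`. CONDITIONAL on the
two displayed inputs «`H²(Γ_K, M) = 0`» and «base lift» (both Poitou–Tate-shaped; tree templates for `E[p^∞]`:
`X11b.WeakLeopoldt.subsingleton_galoisCohomology_two_primary`, `X11b.Coinv.coinvariantsTrivialAt_of_subsingleton`).

WHY u = 1 SUFFICES HERE. In Greenberg's classical setting (true Selmer group, rank ≥ 1) `Sel(F_∞)_Γ ≠ 0` and a TWIST `A_s` is needed;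
for Agboola's RESTRICTED group `𝔖 = 𝔖_{v̄}(K*_∞, W*)` the line's data make `𝔖^Γ` finite and `H(0) ≠ 0` (S3b′'s `HasCharValuationAt`), so
«no nonzero finite `Λ`-submodule» ⟺ `X[T] = 0` ⟺ `𝔖_Γ = 0` ⟺ `conj_γ − 1` onto `𝔖` — file 1's criterion at `u = 1` (`2 ∣ 1 − 1`).
And for the FULL ambient `H = H¹(K*_∞, W*)` the input (ii) «`conj_γ − 1` onto `H`» is EXACTLY «`H²(Γ_K, W*) = 0`» by the
Hochschild–Serre / Shapiro descent `H¹(K_∞, M)_Γ ↪ H²(K, M)` — PROVED generically in the tree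
(`Summit.BirchSwinnertonDyer.Rank1Residual.X11b.ProcyclicDescent.exists_conjH1_sub_eq_of_subsingleton`, JSW17 Lemma 3.3.3 first half,
any profinite `G ↠ ℤ_p`, any `p`-primary discrete module with open stabilisers). For `W*` over `K = ℚ(√−7)`: `H²(K_w, W*) =
(T_v E^{G_{K_w}})^∨ = 0` at every place (finite local torsion) and `Ш²(K, W*) ≅ Ш¹(K, T_v E)^∨ = 0` from `log_v P ≠ 0` (S3c's `ℓ`) and
`#Ш(E_K)[2^∞] < ∞` (GZK) — Poitou–Tate; NOT proved here.

CONTENT.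
* §1 GENERIC (`K`, `p`, `κ` with topological generator `γ`, `p`-primary discrete `M` with open stabilisers, place `𝔮`):
  `exists_conjH1_sub_eq_of_subsingleton_H2` — `H²(Γ_K, M) = 0 ⟹ conj_γ − 1` onto `H¹(K_∞, M)` (the X11b engine, re-exported in the
  `ZpExtension` currency); `conjH1_eq_self_iff_exists_resOfLe` — a class of `H¹(K_∞, M)` is `Γ`-invariant iff it is restricted from
  `H¹(K, M)` (`exists_resSubgroup_eq_of_conjH1_eq` + `conjH1_resOfLe_of_mem`); **`twistedCoinvariants_one_of_subsingleton_H2_of_baseLift`** —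
  `H² = 0` ∧ base lift ⟹ `conj_γ − 1` onto `𝔖_𝔮(K_∞, M)`; **`forall_finite_eq_bot_of_subsingleton_H2_of_baseLift`** — ⟹ no nonzero finite
  `Λ`-submodule of any dual datum (file 1 at `u = 1`).
* §2 ROAD α: **`noFiniteSubmodule_of_frame_of_subsingleton_H2_of_baseLift`** — `hY` of LEAD's p657357 on every S3c frame from
  «`H²(Γ_K, W*) = 0`» ∧ «base lift for `𝔖_{v̄}(K*_∞, W*)`», `W* = ↥((W.baseChange K).endEigenPrimaryTorsion 2 π r)`.
presearch: JSW17 Lemma 3.3.3 (arXiv:1512.06894 pp. 11–12); Greenberg LNM 1716 pp. 122–125; X11b tree files ProcyclicDescent /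
AnticyclotomicCoinvariants (templates) — no new fact.

References: [JetchevSkinnerWan2017] Lemma 3.3.3; [GreenbergLNM1716] §4 pp. 122–125; [Agboola2007] §5 Prop. 5.1;
[SerreGaloisCohomology1997] I §2.5 Prop. 10, I §2.6 (b).
-/

noncomputable section

open scoped Classical

set_option linter.dupNamespace false
set_option autoImplicit false

open NumberField IsDedekindDomain Field WeierstrassCurve
open Literature.NumberTheory.EllipticCurves Literature.NumberTheory.EllipticCurves.GreenbergSelmer
open Literature.NumberTheory.EllipticCurves.Agboola2007
open Literature.NumberTheory.EllipticCurves.IwasawaAlgebra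
open Literature.NumberTheory.EllipticCurves.IwasawaDual
open Literature.NumberTheory.GaloisRepresentations
open Summit.BirchSwinnertonDyer.Rank1Residual.X11b

universe u

namespace Summit.BirchSwinnertonDyer.BirchSwinnertonDyer.Theorems.PrintCf2.RestrictedSelmerPair

/-! ## §1. Generic: `H²(Γ_K, M) = 0` + base lift ⟹ `conj_γ − 1` onto `𝔖_𝔮(K_∞, M)` ⟹ no finite `Λ`-submodule -/

section Generic

variable {K : Type} [Field K] [NumberField K] {p : ℕ} [Fact p.Prime] (κ : ZpExtension K p)
  (M : Type) [AddCommGroup M] [DistribMulAction (absoluteGaloisGroup K) M] [TopologicalSpace M]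
  [DiscreteTopology M] (𝔮 : HeightOneSpectrum (𝓞 K)) {γ : absoluteGaloisGroup K}

omit [NumberField K] in
/-- **`H²(Γ_K, M) = 0 ⟹ conj_γ − 1` is ONTO `H¹(K_∞, M)`** (`M` `p`-primary with open stabilisers, `γ` a topological generator): the
tree's generic procyclic descent `X11b.ProcyclicDescent.exists_conjH1_sub_eq_of_subsingleton` (Shapiro + the long exact sequence of
`0 → M → M_G^H(M) → M_G^H(M) → 0`, JSW17 Lemma 3.3.3 first half "`H¹(K, M)_Γ ↪ H²(K, W)`") in the `ZpExtension` currency. This is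
hypothesis (ii) of file 2 for the FULL ambient `H = ⊤` at `u = 1`. [cite: JetchevSkinnerWan2017, Lemma 3.3.3 (arXiv:1512.06894 pp. 11–12)]
[cite: SerreGaloisCohomology1997, I §2.5 Prop. 10] -/
theorem exists_conjH1_sub_eq_of_subsingleton_H2 (hstab : ∀ m : M, IsOpen {g : absoluteGaloisGroup K | g • m = m})
    (htor : ∀ m : M, ∃ k : ℕ, p ^ k • m = 0) (hγ : κ.IsTopGenerator γ)
    (h2 : Subsingleton (continuousCohomology 2 (discreteTopRep (absoluteGaloisGroup K) M)))
    (x : subgroupH1 κ.kerSubgroup M) :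
    ∃ y : subgroupH1 κ.kerSubgroup M, conjH1 κ.kerSubgroup M γ y - y = x := by
  haveI : CompactSpace (absoluteGaloisGroup K) := absoluteGaloisGroup_compactSpace K
  exact ProcyclicDescent.exists_conjH1_sub_eq_of_subsingleton hstab γ κ.toContinuousMonoidHom κ.surjective hγ htor h2 x

/-- **`Γ`-invariant classes of `H¹(K_∞, M)` are exactly the restrictions from `H¹(K, M)`** (`M` `p`-primary with continuous orbit
maps, `γ` a topological generator): ⟸ inner conjugation (`conjH1_resOfLe_of_mem`), ⟹ Greenberg's Lemma 3.2 at layer `0` (-w7's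
`exists_resOfLe_eq_of_conjH1_eq`, `cd_p ℤ_p = 1`). So the "invariant `c'`" of file 2's lift at `u = 1` is a class FROM THE BASE.
[cite: GreenbergLNM1716, §3 Lemma 3.2 (p. 86)] [cite: JetchevSkinnerWan2017, Lemma 3.3.3 (arXiv:1512.06894 p. 12)] -/
theorem conjH1_eq_self_iff_exists_resOfLe (hcont : ∀ m : M, Continuous fun g : absoluteGaloisGroup K ↦ g • m)
    (htor : ∀ m : M, ∃ k : ℕ, p ^ k • m = 0) (hγ : κ.IsTopGenerator γ) (c : subgroupH1 κ.kerSubgroup M) :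
    conjH1 κ.kerSubgroup M γ c = c ↔
      ∃ z : subgroupH1 (⊤ : Subgroup (absoluteGaloisGroup K)) M, resOfLe M (le_top : κ.kerSubgroup ≤ ⊤) z = c := by
  constructor
  · intro hc
    have hc' : conjH1 κ.kerSubgroup M (γ ^ p ^ 0) c = c := by rw [pow_zero, pow_one]; exact hc
    obtain ⟨x₀, hx₀⟩ := exists_resOfLe_eq_of_conjH1_eq κ M 0 hγ hcont htor c hc'
    refine ⟨resOfLe M (le_of_eq (ZpExtension.layerSubgroup_zero κ).symm) x₀, ?_⟩
    rw [← AddMonoidHom.comp_apply, Literature.NumberTheory.EllipticCurves.resOfLe_comp_holds]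
    exact hx₀
  · rintro ⟨z, rfl⟩
    exact conjH1_resOfLe_of_mem M (le_top : κ.kerSubgroup ≤ ⊤) (Subgroup.mem_top γ) z

/-- **`H²(Γ_K, M) = 0` + BASE LIFT ⟹ `conj_γ − 1` onto `𝔖_𝔮(K_∞, M)`.** The base lift: every class `c ∈ H¹(K_∞, M)` whose
`Γ`-coboundary `conj_γ c − c` lies in `𝔖_𝔮(K_∞, M)` is congruent modulo `𝔖_𝔮(K_∞, M)` to a class restricted from `H¹(K, M)`
(Greenberg's "`H¹(K, M) ↠ 𝒫(M, K_∞)^Γ`" = JSW17 Lemma 3.3.3 second half: local lifts + Poitou–Tate surgery). Then file 2's chase with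
the full ambient `H = ⊤` and `u = 1`. [cite: JetchevSkinnerWan2017, Lemma 3.3.3] [cite: GreenbergLNM1716, §4 pp. 122–125] -/
theorem twistedCoinvariants_one_of_subsingleton_H2_of_baseLift
    (hstab : ∀ m : M, IsOpen {g : absoluteGaloisGroup K | g • m = m})
    (htor : ∀ m : M, ∃ k : ℕ, p ^ k • m = 0) (hγ : κ.IsTopGenerator γ)
    (h2 : Subsingleton (continuousCohomology 2 (discreteTopRep (absoluteGaloisGroup K) M)))
    (hbase : ∀ c : subgroupH1 κ.kerSubgroup M, conjH1 κ.kerSubgroup M γ c - c ∈ restrictedSelmerZp κ M 𝔮 →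
      ∃ z : subgroupH1 (⊤ : Subgroup (absoluteGaloisGroup K)) M,
        c - resOfLe M (le_top : κ.kerSubgroup ≤ ⊤) z ∈ restrictedSelmerZp κ M 𝔮) :
    ∀ s : restrictedSelmerZp κ M 𝔮, ∃ t : restrictedSelmerZp κ M 𝔮, (1 : ℤ) • conjRestricted κ M 𝔮 γ t - t = s := by
  refine twistedCoinvariants_of_lift κ M 𝔮 γ ⊤ le_top 1 (fun s _ ↦ ?_) (fun c _ hc ↦ ?_)
  · obtain ⟨y, hy⟩ := exists_conjH1_sub_eq_of_subsingleton_H2 κ M hstab htor hγ h2 s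
    exact ⟨y, AddSubgroup.mem_top y, by rw [one_zsmul]; exact hy⟩
  · rw [one_zsmul] at hc
    obtain ⟨z, hz⟩ := hbase c hc
    refine ⟨resOfLe M (le_top : κ.kerSubgroup ≤ ⊤) z, AddSubgroup.mem_top _, ?_, hz⟩
    rw [one_zsmul, sub_eq_zero]
    exact conjH1_resOfLe_of_mem M (le_top : κ.kerSubgroup ≤ ⊤) (Subgroup.mem_top γ) z

variable {κ M 𝔮} in
/-- **B17 ⟸ `H²(Γ_K, M) = 0` ∧ base lift** (`M` `p`-primary with open stabilisers and continuous orbit maps, `γ` a topological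
generator): every dual datum of `𝔖_𝔮(K_∞, M)` has no nonzero finite `Λ`-submodule — file 1's criterion at `u = 1`. For Agboola's
module this is the natural form of the brick: no twist is needed because `𝔖^Γ` is finite in the restricted setting.
[cite: JetchevSkinnerWan2017, Lemma 3.3.3] [cite: GreenbergLNM1716, §4 Props. 4.14–4.15] [cite: Agboola2007, §5 Prop. 5.1] -/
theorem forall_finite_eq_bot_of_subsingleton_H2_of_baseLift (D : RestrictedDualData κ M 𝔮 γ)
    (hstab : ∀ m : M, IsOpen {g : absoluteGaloisGroup K | g • m = m})
    (htor : ∀ m : M, ∃ k : ℕ, p ^ k • m = 0) (hγ : κ.IsTopGenerator γ)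
    (h2 : Subsingleton (continuousCohomology 2 (discreteTopRep (absoluteGaloisGroup K) M)))
    (hbase : ∀ c : subgroupH1 κ.kerSubgroup M, conjH1 κ.kerSubgroup M γ c - c ∈ restrictedSelmerZp κ M 𝔮 →
      ∃ z : subgroupH1 (⊤ : Subgroup (absoluteGaloisGroup K)) M,
        c - resOfLe M (le_top : κ.kerSubgroup ≤ ⊤) z ∈ restrictedSelmerZp κ M 𝔮) :
    ∀ N : Submodule (IwasawaAlgebra p) D.X, Finite N → N = ⊥ :=
  forall_finite_eq_bot_of_twistedCoinvariants D htor (u := 1) (by simp)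
    (twistedCoinvariants_one_of_subsingleton_H2_of_baseLift κ M 𝔮 hstab htor hγ h2 hbase)

end Generic

/-! ## §2. Road α: `hY` of p657357 from «`H²(Γ_K, W*) = 0`» and the base lift -/

section Frame

variable {K : Type} [Field K] [NumberField K]

/-- **B17 on every S3c frame ⟸ `H²(Γ_K, W*) = 0` ∧ base lift for `𝔖_{v̄}(K*_∞, W*)`**, `W* = E[𝔮_r^∞] = ↥((W.baseChange K).endEigenPrimaryTorsion 2 π r)`,
any elliptic `W/ℚ`, number field `K`, `π`, `r`, `ℤ₂`-line `κ'` with topological generator `γ'`, place `v̄`, dual datum `D`: the hypothesis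
`hY` of LEAD g11's `control_identity_of_frame_of_noFiniteSubmodule` (p657357). The two inputs are the two halves of JSW17 Lemma 3.3.3 /
Greenberg pp. 122–125 for Agboola's module (tree templates for `E[p^∞]`: `X11b.WeakLeopoldt.subsingleton_galoisCohomology_two_primary`,
`X11b.Coinv.coinvariantsTrivialAt_of_subsingleton`). [cite: JetchevSkinnerWan2017, Lemma 3.3.3] [cite: Agboola2007, §5 Prop. 5.1] -/
theorem noFiniteSubmodule_of_frame_of_subsingleton_H2_of_baseLift (W : WeierstrassCurve ℚ) [W.IsElliptic]
    (π : (W.baseChange K).endRing) (r : ℤ_[2]) (κ' : ZpExtension K 2) {γ' : absoluteGaloisGroup K} (hγ' : κ'.IsTopGenerator γ')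
    (vbar : HeightOneSpectrum (𝓞 K))
    (D : RestrictedDualData κ' ↥((W.baseChange K).endEigenPrimaryTorsion 2 π r) vbar γ')
    (h2 : Subsingleton (continuousCohomology 2
      (discreteTopRep (absoluteGaloisGroup K) ↥((W.baseChange K).endEigenPrimaryTorsion 2 π r))))
    (hbase : ∀ c : subgroupH1 κ'.kerSubgroup ↥((W.baseChange K).endEigenPrimaryTorsion 2 π r),
      conjH1 κ'.kerSubgroup ↥((W.baseChange K).endEigenPrimaryTorsion 2 π r) γ' c - c ∈
          restrictedSelmerZp κ' ↥((W.baseChange K).endEigenPrimaryTorsion 2 π r) vbar →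
        ∃ z : subgroupH1 (⊤ : Subgroup (absoluteGaloisGroup K)) ↥((W.baseChange K).endEigenPrimaryTorsion 2 π r),
          c - resOfLe ↥((W.baseChange K).endEigenPrimaryTorsion 2 π r) (le_top : κ'.kerSubgroup ≤ ⊤) z ∈
            restrictedSelmerZp κ' ↥((W.baseChange K).endEigenPrimaryTorsion 2 π r) vbar) :
    ∀ N : Submodule (IwasawaAlgebra 2) D.X, Finite N → N = ⊥ := by
  haveI : (W.baseChange K).IsElliptic := by rw [baseChange]; infer_instance
  exact forall_finite_eq_bot_of_subsingleton_H2_of_baseLift D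
    (fun m ↦ isOpen_stabilizer_endEigenPrimaryTorsion (W.baseChange K) 2 π r m)
    (exists_pow_smul_endEigenPrimaryTorsion_eq_zero (W.baseChange K) 2 π r) hγ' h2 hbase

end Frame


end Summit.BirchSwinnertonDyer.BirchSwinnertonDyer.Theorems.PrintCf2.RestrictedSelmerPair

end
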